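import Summits.ResolutionOfSingularities.ResolutionOfSingularities.Theorems.WildQuotientsWildQuotientResolutionS1KillExitDefsTame
import Literature.AlgebraicGeometry.Resolution.CobordantBlowupFiltration

/-!
# S1a — the ONE-NODE PRODUCER STEP of `stub_localGame(T)`, TYPED STATEMENT ONLY [OURS · L1 W4.5c · idea-2 g15]

NOT a statement of the manuscript; counted 0; NO proof here (plan-1 LANDABLE QUEUE 2026-08-27T19:39:06Z, item H3:
«a TYPED STATEMENT ONLY of the one-node producer step = the induction invariant of `stub_localGameT`; tri-1/tri-2
vacuity-read it, then it becomes the leadʼs first registered sub-stub»). AI-level work, weaker than expert review.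

v3 (2026-08-27, plan-1 RULING 20:24:48Z «CITE, DONʼT RESTATE», after stub-1ʼs PRESEARCH 20:24:32Z): the extended
weighted Rees algebra of the centre IS Literatureʼs FULL COBORDANT BLOW-UP ALGEBRA
`Literature.AlgebraicGeometry.Resolution.cobordantAlgebra f w = B[t⁻¹, f_i t^{w_i}] ⊆ B[T;T⁻¹]`
([cite: Wlodarczyk2022, Def. 2.3.5], `CobordantBlowupAlgebra.lean`), with `cobordantAlgebra.s f w = T⁻¹` and
`cobordantAlgebra.u' f w i = f_i T^{w_i}`, `= ⊕ₙ 𝒥ₙ tⁿ` for the weighted filtration `weightedFiltration f w`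
(`cobordantAlgebra_eq_extendedRees`, `CobordantBlowupFiltration.lean`); the v1/v2 OURS copies `reesAlgebra` /
`tInv` / `gen` / `weightedIdeal` are WITHDRAWN (no OURS definition of these objects remains). This file keeps only
what Literature does not have: `IsTameNode` (the graded-with-units-and-`σ` node), the D2-T bridge, `ChartClause`,
`CoverClause`, `OneNodeProducerStep`, `coverClause_of_isEmpty`. Regularity of the chart rings (H3a) is stub-1ʼs
`Theorems/…S1aWeightedReesRegular.lean` (p567753) on top of Literature `cobordantAlgebra.isRegularRing`
(`CobordantBlowupRegular.lean`, [cite: Wlodarczyk2022, §2.3.9]).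

## The node object (ring level)

A **tame node** at the prime `p` (`IsTameNode p B 𝒜 σ`) is a REGULAR Noetherian ring `B` graded by an additive
group `ι` (`𝒜 : ι → AddSubgroup B`, `GradedRing 𝒜`; in the game `ι = ℤᵃ` after `a` weighted moves, or
`ℤᵃ × (finite)`), with (T1) finitely many homogeneous units whose degrees generate a finite-index subgroup of `ι`,
(T2) finite generation over the degree-`0` part, and a GRADED ring automorphism `σ` with `σ^[p] = id` (the lifted
`ℤ/p`-action; `σ = 1` = a KILLED node). Its UPSTAIRS chart is `Spec (𝒜 0)` (a diagonal root chart, D2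
`S1.IsDiagonalRootChart`, indeed tame: `isTameRootChart_degreeZero_of_isTameNode`), its QUOTIENT chart is
`Spec ((𝒜 0)^σ) = Spec ((B^σ)₀)` (`S1.UnitDescent.fixed_inter_subring`), which at a LEAF (K–L KILL of `σ` on `B`,
slice-kill or the REES KILL LEMMA `S1.ReesKill.invariants_regular_of_unit_generator`) is again the degree-`0` part
of a regular graded ring with units, i.e. a tame root chart (D2-T `S1.IsTameRootChart`) — the (E-a) end state.

## The move (ring level)

A CENTRE on the node is `f : Fin c → B` homogeneous (`f i ∈ 𝒜 (δ i)`) with weights `0 < w i`, K1′-REGULAR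
(`f` is a `B`-regular sequence and `B ⧸ (f)` is a regular ring — on a regular `B` this says: along `V(f)` the
`f i` are part of a regular system of parameters) and σ-ADAPTED (σ preserves the weighted filtration
`𝒥ₙ = (∏ f_i^{a_i} : Σ a_i w_i ≥ n)`, Literature `weightedFiltration f w`). The EXTENDED WEIGHTED REES ALGEBRA is
Literatureʼs full cobordant blow-up algebra `R^w = cobordantAlgebra f w = B[T⁻¹, f_i T^{w_i}] ⊆ B[T;T⁻¹]`
(`= ⊕ₙ 𝒥ₙ Tⁿ`, `cobordantAlgebra_eq_extendedRees`), graded by `ℤ × ι` (`b T^d ↦ (d, deg b)`), on which `σ` acts by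
`σ_T := σ ⊗ (T ↦ T)`.

CHARTS. The σ-STABLE affine charts of the weighted blow-up are NOT the standard Rees charts `D₊(f_i T^{w_i})`
(counter-example: `σ x = x + y²`, weights `(2,1)`: `σ_T (x T²) = x T² + (y T)²` is not a unit on `D₊(x T²)`), but the
opens `D₊(h)` for `σ_T`-INVARIANT homogeneous `h = b T^d ∈ R^w` of POSITIVE `T`-degree (`σ b = b`, `0 < d`; e.g. the
norms `N(f_i T^{w_i}) = ∏_{k<p} σ_T^k (f_i T^{w_i})` and norms of combinations): the chart ring is
`C_h := R^w[h⁻¹] = Localization.Away h`, with the induced `ℤ × ι`-grading and the canonical extension `σ'` of `σ_T`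
(`h` invariant ⇒ `σ_T` extends to the localization). The COARSE upstairs chart of the move is `Spec (C_h)₍₀,·₎…`,
precisely `Spec (𝒜' 0)` for the new grading — again of the node shape, one grading rank higher («ℤ-graded chart ↦
ℤ²-graded Rees charts»).

## The typed statement `OneNodeProducerStep p`

For every tame node `(B, 𝒜, σ)` at `p` and every K1′-regular σ-adapted homogeneous weighted centre `(f, δ, w)`:
(CHART) for every σ-invariant homogeneous `h = b T^d ∈ R^w` with `0 < d`, the chart ring `Localization.Away h`
carries a `ℤ × ι`-grading `𝒜'` and a ring automorphism `σ'` making it a TAME NODE at `p`, PINNED to the move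
(anti-costume): `𝒜'` is the Rees bigrading (`b' T^{d'} ↦ (d', deg b')` on the image of `R^w`), `σ'` restricts to
`σ` on `B` and fixes `T⁻¹`; (COVER) finitely many such invariant `h_l` cover the blow-up: every `f_i T^{w_i}` is
nilpotent modulo the ideal `(h_l)_l` of `R^w` (so `⋃ D₊(h_l) = ⋃ D₊(f_i T^{w_i}) = Bl`).
What is NOT in this statement (next items to type, scheme level): the glueing of the coarse charts `Spec (𝒜'_l 0)`
to the weighted blow-up `V' → Spec (𝒜 0)`, its properness/birationality and `G`-equivariance, and the
`LocallyDiagonalRootRegular`/stable-affine-cover clauses of `S1.KillTameModel` — those are chart-independent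
bookkeeping once (CHART)+(COVER) hold.

Truth status (AI-level): (T1)/(T2)/Noetherian/lifted action/cover are routine; the load-bearing claim is the
REGULARITY of `R^w[h⁻¹]` ⊆ ⋃ D(f_i T^{w_i})`, i.e. of the standard weighted Rees charts of a K1′-regular centre on a
regular ring («weighted blow-ups of regular schemes in regular weighted centres are regular as stacks»; presentation
`R^w ≅ B[S, X̄]/(X̄_i S^{w_i} − f_i)`). Refute/sharpen there first.
-/

set_option linter.dupNamespace false

noncomputable section

open Literature.AlgebraicGeometry.Resolution
open scoped LaurentPolynomial

namespace Summit.ResolutionOfSingularities.ResolutionOfSingularities.Theorems.WildQuotientResolution.S1.ProducerStep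

universe u v

/-! ## Tame nodes -/

/-- **Tame node** at the prime `p`: a regular Noetherian ring `B` graded by the additive group `ι`
(`𝒜 : ι → AddSubgroup B`), with (T1) finitely many homogeneous units whose degrees generate a finite-index subgroup
of `ι`, (T2) finitely many ring generators over the degree-`0` part, and a graded ring automorphism `σ` of order
dividing `p` (`σ = 1` allowed: a KILLED node). [OURS · L1 W4.5c] -/
def IsTameNode (p : ℕ) {ι : Type v} [AddCommGroup ι] [DecidableEq ι] (B : Type u) [CommRing B]
    (𝒜 : ι → AddSubgroup B) [GradedRing 𝒜] (σ : B ≃+* B) : Prop :=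
  IsNoetherianRing B ∧ IsRegularRing B ∧
    (∃ s : Finset ι, (∀ d ∈ s, ∃ u : B, IsUnit u ∧ u ∈ 𝒜 d) ∧
      (AddSubgroup.closure (s : Set ι)).FiniteIndex) ∧
    (∃ t : Finset B, Subring.closure (((𝒜 0 : AddSubgroup B) : Set B) ∪ ↑t) = ⊤) ∧
    (∀ d : ι, ∀ b ∈ 𝒜 d, σ b ∈ 𝒜 d) ∧ (∀ b : B, (⇑σ)^[p] b = b)

/-- D2-T compatibility (anti-vacuity of the node notion): the degree-`0` part of a tame node graded by
`Π j, ZMod (r j)` is a tame root chart in the sense of `S1.IsTameRootChart`. -/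
theorem isTameRootChart_degreeZero_of_isTameNode (p : ℕ) {m : ℕ} (r : Fin m → ℕ) (B : Type u) [CommRing B]
    (𝒜 : (Π j : Fin m, ZMod (r j)) → AddSubgroup B) [GradedRing 𝒜] (σ : B ≃+* B)
    (h : IsTameNode p B 𝒜 σ) : IsTameRootChart (↥(𝒜 0)) := by
  obtain ⟨hN, hR, hT1, hT2, -, -⟩ := h
  exact ⟨m, r, B, inferInstance, 𝒜, inferInstance, hN, hR, hT1, hT2, ⟨RingEquiv.refl _⟩⟩

/-! ## The producer step -/

section Statement

variable (p : ℕ)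

/-- **(CHART)** For the tame node `(B, 𝒜, σ)` and the centre `(f, δ, w)`: every `σ`-invariant homogeneous element
`h = b T^d ∈ R^w` of positive `T`-degree gives a chart ring `R^w[h⁻¹]` which, with a `ℤ × ι`-grading `𝒜'` EQUAL to
the Rees bigrading on the image of `R^w` and a ring automorphism `σ'` EXTENDING `σ ⊗ (T ↦ T)`, is again a tame
node at `p`. [OURS · L1 W4.5c] -/
def ChartClause {ι : Type v} [AddCommGroup ι] [DecidableEq ι] (B : Type u) [CommRing B]
    (𝒜 : ι → AddSubgroup B) [GradedRing 𝒜] (σ : B ≃+* B) {c : ℕ} (f : Fin c → B) (w : Fin c → ℕ) : Prop :=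
  ∀ (d : ℤ) (δ : ι) (b : B), 0 < d → b ∈ 𝒜 δ → σ b = b →
    ∀ hmem : LaurentPolynomial.C b * LaurentPolynomial.T d ∈ cobordantAlgebra f w,
      ∃ (𝒜' : ℤ × ι → AddSubgroup (Localization.Away (⟨_, hmem⟩ : ↥(cobordantAlgebra f w))))
        (_ : GradedRing 𝒜')
        (σ' : Localization.Away (⟨_, hmem⟩ : ↥(cobordantAlgebra f w)) ≃+*
          Localization.Away (⟨_, hmem⟩ : ↥(cobordantAlgebra f w))),
        IsTameNode p (Localization.Away (⟨_, hmem⟩ : ↥(cobordantAlgebra f w))) 𝒜' σ' ∧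
        -- the grading IS the Rees bigrading `b' T^{d'} ↦ (d', deg b')`
        (∀ (d' : ℤ) (δ' : ι) (b' : B), b' ∈ 𝒜 δ' →
          ∀ hmem' : LaurentPolynomial.C b' * LaurentPolynomial.T d' ∈ cobordantAlgebra f w,
            algebraMap (↥(cobordantAlgebra f w)) (Localization.Away (⟨_, hmem⟩ : ↥(cobordantAlgebra f w)))
              ⟨_, hmem'⟩ ∈ 𝒜' (d', δ')) ∧
        -- `σ'` extends `σ` on `B` …
        (∀ b' : B,
          σ' (algebraMap (↥(cobordantAlgebra f w)) _ (algebraMap B (↥(cobordantAlgebra f w)) b')) =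
            algebraMap (↥(cobordantAlgebra f w)) _ (algebraMap B (↥(cobordantAlgebra f w)) (σ b'))) ∧
        -- … and fixes `T⁻¹`
        σ' (algebraMap (↥(cobordantAlgebra f w)) _ (cobordantAlgebra.s f w)) = algebraMap (↥(cobordantAlgebra f w)) _ (cobordantAlgebra.s f w)

/-- **(COVER)** Finitely many `σ`-invariant homogeneous elements `h_l = b_l T^{d_l} ∈ R^w` of positive `T`-degree
cover the blow-up: every standard generator `f_i T^{w_i}` is nilpotent modulo the ideal `(h_l)_l` of `R^w`.
[OURS · L1 W4.5c] -/
def CoverClause {ι : Type v} [AddCommGroup ι] [DecidableEq ι] (B : Type u) [CommRing B]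
    (𝒜 : ι → AddSubgroup B) [GradedRing 𝒜] (σ : B ≃+* B) {c : ℕ} (f : Fin c → B) (w : Fin c → ℕ) : Prop :=
  ∃ (l : ℕ) (d : Fin l → ℤ) (δ : Fin l → ι) (b : Fin l → B)
    (hmem : ∀ j, LaurentPolynomial.C (b j) * LaurentPolynomial.T (d j) ∈ cobordantAlgebra f w),
    (∀ j, 0 < d j ∧ b j ∈ 𝒜 (δ j) ∧ σ (b j) = b j) ∧
    ∀ i : Fin c, ∃ N : ℕ,
      cobordantAlgebra.u' f w i ^ N ∈ Ideal.span (Set.range fun j => (⟨_, hmem j⟩ : ↥(cobordantAlgebra f w)))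

/-- **ONE-NODE PRODUCER STEP at the prime `p`** (the induction invariant of `stub_localGameT`, typed; NO proof in
this file): a K1′-regular, σ-adapted, homogeneous weighted blow-up of a tame node is covered by finitely many
σ-stable Rees charts which are again tame nodes, one grading rank higher, with the lifted action and units.
Hypotheses on the centre: `f i` homogeneous of degree `δ i`, weights `0 < w i`, `f` a `B`-regular sequence with
`B ⧸ (f)` regular (K1′-regularity), and `σ (I_d) ⊆ I_d` for the weighted filtration (σ-adaptedness).
[OURS · L1 W4.5c] -/
def OneNodeProducerStep : Prop :=
  ∀ (ι : Type) [AddCommGroup ι] [DecidableEq ι] (B : Type) [CommRing B]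
    (𝒜 : ι → AddSubgroup B) [GradedRing 𝒜] (σ : B ≃+* B),
    IsTameNode p B 𝒜 σ →
    ∀ (c : ℕ) (f : Fin c → B) (δ : Fin c → ι) (w : Fin c → ℕ),
      (∀ i, f i ∈ 𝒜 (δ i)) → (∀ i, 0 < w i) →
      RingTheory.Sequence.IsRegular B (List.ofFn f) →
      IsRegularRing (B ⧸ Ideal.span (Set.range f)) →
      (∀ n : ℕ, ((weightedFiltration f w).ideal n).map (σ : B →+* B) ≤ (weightedFiltration f w).ideal n) →
      ChartClause p B 𝒜 σ f w ∧ CoverClause B 𝒜 σ f w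

end Statement

/-! ## Sanity: the empty centre and the trivial node -/

/-- With the empty centre (`c = 0`) the cover clause holds with no charts (nothing to cover). -/
theorem coverClause_of_isEmpty {ι : Type v} [AddCommGroup ι] [DecidableEq ι] (B : Type u) [CommRing B]
    (𝒜 : ι → AddSubgroup B) [GradedRing 𝒜] (σ : B ≃+* B) (f : Fin 0 → B) (w : Fin 0 → ℕ) :
    CoverClause B 𝒜 σ f w :=
  ⟨0, Fin.elim0, Fin.elim0, Fin.elim0, fun j => Fin.elim0 j, fun j => Fin.elim0 j, fun i => Fin.elim0 i⟩

end Summit.ResolutionOfSingularities.ResolutionOfSingularities.Theorems.WildQuotientResolution.S1.ProducerStep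

end
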